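import Literature.MathematicalPhysics.QuantumFieldTheory.Balaban1983to89.B8Thm2TorusCoverGCOfProp6
import Literature.MathematicalPhysics.QuantumFieldTheory.Balaban1983to89.B9B8KnitCurvatureSmallness

/-!
# [B8] Theorem 2 on the torus, cover form, FROM ANY BOND-SECTOR MEMBER ASSEMBLER: the per-member binder (1ₛ) ∧ (Eₛ) of the form of record
# `B8Thm2TorusCoverGCOfProp6.hThm2Cover_of_prop6_deltaAMembers` discharged against the TARGET SIGNATURE of module M5.7's member assembler
# (sub-row G-B8-T2S «[B8] §3 Thm 2 TORUS SUPPLIER», seat t2s-1 gen 17)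

T. Bałaban, *Spaces of regular gauge field configurations on a lattice and gauge fixing conditions*, Commun. Math. Phys. **99** (1985) 75–102
[`Balaban1985RegularSpaces`, "[B8]"]: Thm 2 p. 83, (1.33)–(1.39) pp. 82–83, (1.7)–(1.8) p. 77 (the regime `𝔄_k`: plaquette variables near 1 at every scale),
Prop. 6 (1.135)–(1.138) p. 99.  T. Bałaban, *Propagators for lattice gauge theories in a background field*, Commun. Math. Phys. **99** (1985) 389–434
[`Balaban1985BackgroundPropagators`, "[B9]"]: Thm 3.3 p. 399 (the propagator `G = Δ_a⁻¹`, (3.42) p. 397) via Thm 3.10 pp. 414–416 ((3.105)–(3.106) p. 414),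
(3.35)–(3.37) p. 396 (the cube class), Cor. 3.6 p. 408, (3.69) p. 404 (plaquette variables of the background near 1).  [4] = [`Balaban1984PropagatorsII`]
Lemma 2.1 (2.60)–(2.63) p. 234.

statement-level skeleton of published theorems with citation tags; proofs where landed; nothing here is a claim about the Yang–Mills mass gap

WHY THIS FILE (cell `lit-balaban`; seat t2s-1 gen 17).  The torus Thm 2 cover interface OF RECORD, `B8Thm2TorusCoverGCOfProp6.hThm2Cover_of_prop6_deltaAMembers`
(t2s-1 g12), displays per shape-member exactly two statements: (1ₛ) `IsUnit Δ_a(bgY i U₀; parSymY)` and (Eₛ) the (3.42) block of `G_a = Δ_a⁻¹` for every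
background family through `bgY i U₀` — module M5.7's endpoint currency ([B9] Thm 3.10 ⇒ Thm 3.3).  Their supplier is the bond-sector MEMBER ASSEMBLER (M5.7's
`B9Thm310DeltaAIsUnitOfExpansion.eBlock_kernelFamilyBInv_GAY_of_localInverseCubes''` ∕ `isUnit_deltaAY_of_localInverse` at a member from Cor. 3.6's per-cube (3.35)
data, its four (3.105) families read off the family records), which is NOT in the tree at the time of writing (the families' lanes are in flight).  THIS FILE does
now everything the t2s-1 side can do: it FIXES THE ASSEMBLER'S TARGET SIGNATURE IN THE KERNEL — p33 FILE 9's binder prefix (`B9Cor36GpCoverBindersUnitary.eBlock_GpY_of_cubeData_unitary`,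
the `G′`-member's supplier, consumed by g12) plus ONE plaquette-datum window, conclusion (1ₛ) ∧ (Eₛ) — by CONSUMING it: from ANY theorem of that shape the cover
form of Thm 2 follows with NO per-member analytic statement displayed.  On the way it discharges, at the member, the plaquette datum that M5.7's `…localInverseCubes''`
displays (`‖U₁(∂p) − 1‖ ≤ δ̂·(L^{lev p})⁻²`, print's (3.69)-region estimate «the estimates follow directly from the assumptions (3.35), (3.37)» p. 404) from [B8]'s
regime (1.7) (`U₀ ∈ 𝔄_{m′}` ⇒ `Reg17`; t2s-1 g8 `B9B8KnitCurvatureSmallness.norm_holY_bgY_sub_one_lt`), feeds [B8] Prop. 6's per-cube data (`exists_cubeData_of_prop6`)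
at the assembler's (3.37) size, and books the assembler's member thresholds above one big-block exponent (`exists_threshold_exponent`) — the g12 §3 pattern.  So the
LAST junction of the sub-row is reduced to ONE application: `hThm2Cover_of_prop6_deltaAAssembler … ⟨δ_A, K_A, M₀, T₀, N₀, …, the assembler⟩`.
TARGET-SIGNATURE MEMO (constants discipline, which M5.7 endpoint, status of its displayed inputs): `run/shared/lean/pub/lit-balaban/lit-balaban-t2s-1/g17/LAST-JUNCTION-TARGET.md`.

WHAT THIS FILE PROVES (ONE THEOREM; 0 `def`, 0 `def … : Prop`, 0 sorry; standard axioms).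
* ★★★★★ `hThm2Cover_of_prop6_deltaAAssembler` — (ASSEMBLER SIGNATURE) → `∃ δ_E > 0, ∃ d′ A₀, ∀ a′ ≥ A₀, ∃ c_P > 0, ∃ B_E > 0, ∃ a_J > 0, ∀ a_T ⟨windows⟩, a_T ≤ c_P →
  ∀ α₀′ ⟨windows⟩ → ∃ a₀′ k₀ c_α, ∀ c_L ⟨windows⟩, ∃ B₁ B₂ c₁ > 0, ∀ F n K, n < K → P ∣ P′ ∧ L^{K−n} ∣ P ∧ Thm2TorusAt (ℓ+1) (K−n) P′ (eta F n K) 0 B₁ B₂ c₁ len SU(2) ⊤`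
  (`δ_E := δ_A`; `B_E := max K_A 1`; `c_P := min (g12's c_P) (min (Prop. 6's at a₁) δ̂₀)`; the numeric windows are the record's, jointly inhabited by
  `B8Thm2TorusCoverGCOfProp6.exists_admissible_sizes_below` for any positive parameters).

CONSTANTS DISCIPLINE THE SIGNATURE ENCODES (for the assembler's author).  `δ_A` member- and exponent-free (it is fed as the record's `δ_E` before `∃ d′ A₀`);
`K_A` member-free (the record's `B_E` slot sits after `a′`; a `K_A` depending on the big-block exponent is served by instantiating this theorem per `a′` — or ask
t2s-1 for the `∀ a′, ∃ K_A` twin); thresholds only through `L·M_h`, `R·(L·M_h)`, `RM1 i` (no threshold on the level `m′` or on `K − n`); smallness in `α₀` only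
through `a₁` (Prop. 6's «for α₀ sufficiently small» is supplied here) and `δ̂₀`.

HONEST SCOPE.  The assembler is the displayed HYPOTHESIS of the theorem (an implication — nothing here proves [B9] Thm 3.3 for `Δ_a⁻¹` at the member); the
form of record, [B8] Prop. 6 (pub-ymgap `prop6At_bgZd_allTorus_holds` through t2s-1 g9 G4∕G5 ∕ g12 §1), the `G′`- and `C`-members (p33 FILE 9, p21 FILE 10-D) and
the knit-side plaquette datum (g8 F5) are consumed BY NAME; DESIGN bookkeeping: `max K_A 1`, the `min` window, `δ̂ := α₀`.  `stub_PV3A` NOT discharged; no summit ∕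
node statement proved; nothing continuum ∕ ℝ⁴ ∕ OS — the Yang–Mills mass gap is NOT proved by any of this.  `--supports stmt-QuantumFields-19200`.
RELATED, NOT DUPLICATED (searched 2026-08-29: `lean search 'DeltaAAssembler|TorusCoverOfAssembler|thm2Cover_of_assembler' --decl` ∅; `rg -l
"localInverseCubes''_of_reg335P|isUnit_deltaAY_of_localInverse"` over Literature∕Summits = the two defining M5.7 files only — no member-level caller exists).
-/

noncomputable section

namespace Literature.MathematicalPhysics.QuantumFieldTheory.Balaban1983to89.B8Thm2TorusCoverOfDeltaAAssembler

open scoped BigOperators Matrix Matrix.Norms.L2Operator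
open Node00 B6KLevelCensusIndexV1
open B7Prop1Explicit renaming Site → LSite
open B7Prop1Explicit (e)
open B7Prop2Explicit (unitaryUnits C0 c2')
open B4PartitionUnity22 (thetaProf D1)
open B9Eq39Adjoint (fluct covD)
open B6Cover236MultiLevelBlocks (cubes)
open B6GlobalChartV1 (PV boxEquiv)
open B6Ineq2142KLevelV1 (β)
open B9BackgroundsKLevelV1 (shiftsV1)
open B9Eq360DeltaPrimeAY (AfldY)
open B9CubeGeometryInputs (RM1)
open B9GeoNormsKLevelV1 (geo9K)
open B9FromB6 (EBlock)
open B9CubeLettersInvReadings (kernelFamilyBInv)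
open B9Cor36CubeCutoffs (SC NearC)
open B8Ineq132 (InAk)
open B8Thm2TorusLettersPerOfKnit (bgY bgY_mem)
open B9Eq316AveragingTransposeZd (betaTau alphaQ Reg17 reg17_mono reg17_of_inAk)
open B7Prop2SpecialUnitary (specialUnitaryUnits)
open B8Thm2TorusAt (Thm2TorusAt)
open T4TermwiseTorus (IsPeriodic)
open T3ContinuumYM3Torus (T3Family)
open T3SectALandauChart (eta eta_pos)
open B8Thm2TorusCoverOfEBlock (surjective_beta_kIdx_of_constLev)
open B8Thm2TorusCoverGCOfProp6 (exists_cubeData_of_prop6 exists_threshold_exponent hThm2Cover_of_prop6_deltaAMembers)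
open B9Thm37GpAtCoverLarge (eBlock_mono')
open B9B8KnitCurvatureSmallness (norm_holY_bgY_sub_one_lt)
open Node00.OpsYNablaBridge (chartY)

variable {ℓ : ℕ} {hL : Odd (ℓ + 1) ∧ 1 < ℓ + 1} {hd₃ : 1 ≤ 2 + 1}
variable [instF : ∀ i : KIdx 2 ℓ hd₃ hL 1 1, Fintype (geo9K i).Site] [instD : ∀ i : KIdx 2 ℓ hd₃ hL 1 1, DecidableEq (geo9K i).Site]

/-- ★★★★★ **THE TORUS THM 2 COVER FORM FROM ANY BOND-SECTOR MEMBER ASSEMBLER** (`d + 1 = 3`, `N = 2`, `G = U(2)`).  HYPOTHESIS (displayed, the antecedent of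
the implication; NOT a named fact): a theorem of the shape of p33's FILE 9 `B9Cor36GpCoverBindersUnitary.eBlock_GpY_of_cubeData_unitary` for the bond sector —
constants `δ_A > 0`, `K_A ≥ 0`, thresholds `M₀ T₀ N₀`, a (3.37) size `a₁ > 0` and a plaquette-datum window `δ̂₀ > 0`, then at EVERY member `i` above the thresholds with
`c_f = L^{k}`, every section `ιB` of the carrier-block map, every `U(2)`-valued `U` with the (3.69)-type plaquette datum `‖U(∂p) − 1‖ ≤ δ̂·L^{−2·lev}` (`0 ≤ δ̂ ≤ δ̂₀`) and
every family of per-cube (3.35) data `(u_□, A_□, Q_□, C_□, ξ_□, Λ_□)_□` (Cor. 3.6's gauges and potentials; the twelve clauses of FILE 9 ∕ `exists_cubeData_of_prop6`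
verbatim): (1ₛ) `IsUnit Δ_a(U; parSymY)` and (Eₛ) the (3.42) block `EBlock (kernelFamilyBInv i B cfg (GAY i parSymY parBY G′) par) K_A δ_A U₁` for every background
family through `U` — i.e. [B9] Thm 3.3 for `G = Δ_a⁻¹` via Thm 3.10 AT THE MEMBER FROM CUBE DATA (module M5.7's endpoint
`B9Thm310DeltaAIsUnitOfExpansion.eBlock_kernelFamilyBInv_GAY_of_localInverseCubes''` ∕ `isUnit_deltaAY_of_localInverse` assembled over the four (3.105) families; NOT in
the tree at the time of writing — this file fixes its TARGET SIGNATURE in the kernel by consuming it).  CONCLUSION: t2s-1 g12's form of record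
`B8Thm2TorusCoverGCOfProp6.hThm2Cover_of_prop6_deltaAMembers` with its per-member binder (1ₛ) ∧ (Eₛ) DISCHARGED — NO analytic member statement displayed: `∃ δ_E > 0,
∃ d′ A₀, ∀ a′ ≥ A₀, ∃ c_P > 0, ∃ B_E > 0, ∃ a_J > 0, ∀ a_T ⟨FILE 4 ∕ F7 windows⟩, a_T ≤ c_P → ∀ α₀′ ⟨class windows⟩ → ∃ a₀′ k₀ c_α, ∀ c_L ⟨windows⟩, ∃ B₁ B₂ c₁ > 0,
∀ F n K, n < K → P ∣ P′ ∧ L^{K−n} ∣ P ∧ Thm2TorusAt (ℓ+1) (K−n) P′ (eta F n K) 0 B₁ B₂ c₁ len SU(2) ⊤` (`δ_E := δ_A`, `B_E := max K_A 1`, `c_P := min` of g12's window,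
Prop. 6's smallness at the assembler's size `a₁`, and `δ̂₀`).  INSIDE: per member, the section `Function.surjInv` (G9 §1), `bgY i U₀ ∈ U(2)`, periodicity in the
member's letter, the per-cube (3.35) data from [B8] Prop. 6 (`exists_cubeData_of_prop6` at `α₀ ≤ c_P`), and the plaquette datum at `δ̂ := α₀` from the regime (1.7)
(`InAk ⇒ Reg17`, t2s-1 g8 `B9B8KnitCurvatureSmallness.norm_holY_bgY_sub_one_lt`: `‖U(∂p) − 1‖ < α₀L^{−2n}` on every torus plaquette of a constant-level member).
HONEST SCOPE: the assembler is a HYPOTHESIS of this theorem (an implication; nothing here proves it); all numeric windows are the record's; `stub_PV3A` NOT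
discharged; no summit ∕ node statement proved; nothing continuum ∕ ℝ⁴ ∕ OS — the Yang–Mills mass gap is NOT proved by any of this.
[cite: Balaban1985RegularSpaces, Thm 2 p.83, (1.33)–(1.39) pp.82–83, (1.7)–(1.8) p.77, Prop. 6 (1.135)–(1.138) p.99; Balaban1985BackgroundPropagators, Thm 3.3 p.399 via Thm 3.10 pp.414–416, (3.42) p.397, (3.35)–(3.37) p.396, Cor. 3.6 p.408, (3.69) p.404, (3.105)–(3.106) p.414; Balaban1984PropagatorsII, Lemma 2.1 (2.60)–(2.63) p.234] -/
theorem hThm2Cover_of_prop6_deltaAAssembler (hℓ : 4 ≤ ℓ)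
    (τ : (Matrix (Fin 2) (Fin 2) ℂ) →ₗ[ℂ] ℂ) (hτ : ∀ a, τ a = Matrix.trace a) (hτt : ∀ a b, τ (a * b) = τ (b * a))
    {Cτ : ℝ} (hCτ : ∀ x y : (Matrix (Fin 2) (Fin 2) ℂ), |(τ (star x * y)).re| ≤ Cτ * ‖x‖ * ‖y‖)
    {M : ℝ} (hM1 : 1 ≤ M) {α : ℝ} (hαE0 : 0 < α) (hα1 : α < 1)
    {len : LSite (2 + 1) → ℝ}
    {ι : Type} [Fintype ι] [DecidableEq ι] (b : Module.Basis ι ℝ (Matrix (Fin 2) (Fin 2) ℂ)) {M₂ : ℝ} (hM₂ : 0 ≤ M₂)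
    (hrepr : ∀ (v : (Matrix (Fin 2) (Fin 2) ℂ)) (j : ι), |b.repr v j| ≤ M₂ * ‖v‖)
    (Rr : ℝ) (Hp Hg : Prop) :
    letI : CStarAlgebra (Matrix (Fin 2) (Fin 2) ℂ) := {}
    -- ══ HYPOTHESIS: the bond-sector member assembler (TARGET SIGNATURE; FILE 9's binder prefix + a plaquette-datum window; conclusion (1ₛ) ∧ (Eₛ)) ══
    (∃ δA KA M₀ T₀ : ℝ, ∃ N₀ : ℕ, 0 < δA ∧ 0 ≤ KA ∧ ∃ a₁ : ℝ, 0 < a₁ ∧ ∃ δh₀ : ℝ, 0 < δh₀ ∧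
      ∀ (i : KIdx 2 ℓ hd₃ hL 1 1),
        M₀ ≤ ((ℓ : ℝ) + 1) * (toKT i).Mh → N₀ + 1 ≤ (toKT i).R * ((ℓ + 1) * (toKT i).Mh) → T₀ ≤ RM1 i →
        i.cf = (((ℓ + 1 : ℕ) : ℝ)) ^ i.k →
      ∀ (ιB : BlkY i → IBondY i), (∀ s, β i.hN i.D i.hk (ιB s) = s) →
      ∀ (U : CfgY (Matrix (Fin 2) (Fin 2) ℂ) i), (∀ μ x, U μ x ∈ unitaryUnits (Matrix (Fin 2) (Fin 2) ℂ)) →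
      ∀ (δh : ℝ), 0 ≤ δh → δh ≤ δh₀ →
        (∀ p : PlaqY i, ‖((holY i U p : (Matrix (Fin 2) (Fin 2) ℂ)ˣ) : Matrix (Fin 2) (Fin 2) ℂ) - 1‖ ≤
          δh * ((((ℓ : ℝ) + 1) ^ levY i (chartY i p.src))⁻¹) ^ 2) →
      ∀ (g : ↥(cubes (toKT i).D.toDomains) → GaugeY (Matrix (Fin 2) (Fin 2) ℂ) i),
        (∀ c x, ‖(g c x : Matrix (Fin 2) (Fin 2) ℂ)‖ ≤ 1 ∧ ‖(((g c x)⁻¹ : (Matrix (Fin 2) (Fin 2) ℂ)ˣ) : Matrix (Fin 2) (Fin 2) ℂ)‖ ≤ 1) →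
      ∀ (A : ↥(cubes (toKT i).D.toDomains) → AfldY (Matrix (Fin 2) (Fin 2) ℂ) i)
        (Q : ↥(cubes (toKT i).D.toDomains) → Set (Site (PV 2 ℓ i.m i.K hd₃ hL) 0)) (C ξ Λ : ↥(cubes (toKT i).D.toDomains) → ℝ),
        (∀ c, 0 ≤ C c) → (∀ c, 0 < ξ c) → (∀ c, 1 ≤ Λ c) → (∀ c, ξ c ≤ 5 * (SC i c : ℝ) * (kGeo i).eta) →
        (∀ c, LatticeNorms.scaleLen ((ℓ : ℝ) + 1) (kGeo i).eta (c.1.1 + 1) ≤ Λ c * ξ c) →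
        (∀ c, ∀ x : Site (PV 2 ℓ i.m i.K hd₃ hL) 0, NearC i c (35 * SC i c / 8 + 1) (boxEquiv i.hN x).1 → x ∈ Q c) →
        (∀ c, ∀ (κ : Fin (2 + 1)) (x : Site (PV 2 ℓ i.m i.K hd₃ hL) 0), x ∈ Q c → x.shift κ ∈ Q c →
          gaugeY i (g c) U κ x = fluct (kGeo i).eta (A c) κ x) →
        (∀ c, ∀ κ, ∀ x ∈ Q c, ‖A c κ x‖ ≤ C c * (ξ c)⁻¹) →
        (∀ c, ∀ μ ν, ∀ x ∈ Q c,
          ‖(((kGeo i).eta : ℂ)⁻¹) • covD (shiftsV1 (PV 2 ℓ i.m i.K hd₃ hL)) (fun _ _ => (1 : (Matrix (Fin 2) (Fin 2) ℂ)ˣ)) μ (A c ν) x‖ ≤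
            C c * (ξ c ^ 2)⁻¹) →
        (∀ c, max (C c) (C c * (1 + D1 thetaProf)) * Λ c ^ 2 ≤ a₁) → (∀ c, max (C c) (C c * (1 + D1 thetaProf)) * Λ c ^ 2 ≤ 1 / 4) →
      ∀ {B : B9.Backgrounds} (cfg : B.Cfg → CfgY (Matrix (Fin 2) (Fin 2) ℂ) i) (par : BondParY (Matrix (Fin 2) (Fin 2) ℂ) i) (U₁ : B.Cfg), cfg U₁ = U →
        IsUnit (deltaAY i (parSymY i) (parBY i) (GpY i (parSymY i)) U) ∧
        EBlock (kernelFamilyBInv i B cfg (GAY i (parSymY i) (parBY i) (GpY i (parSymY i))) par) KA δA U₁) →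
    -- ══ CONCLUSION: the torus Thm 2 cover form of record with NO per-member analytic statement displayed ══
    ∃ δE : ℝ, 0 < δE ∧ ∃ d' A₀ : ℕ, ∀ a' : ℕ, A₀ ≤ a' → ∃ cP : ℝ, 0 < cP ∧ ∃ BE : ℝ, 0 < BE ∧ ∃ aJ : ℝ, 0 < aJ ∧
    ∀ aT : ℝ, 0 < aT → aT ≤ alphaQ (2 + 1) (ℓ + 1) / ((ℓ + 1 : ℕ) : ℝ) ^ 2 → C0 (2 + 1) * aT ≤ 1 / 3 → 2 * aT ≤ c2' (2 + 1) (ℓ + 1) →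
      2 * ((48 * (((2 : ℕ) : ℝ) + 1) + 14 * ((2 : ℕ) : ℝ) * M + (32 * (((2 : ℕ) : ℝ) + 2) ^ 2 +
        12 * (((2 : ℕ) : ℝ) + 1) ^ 2 * (13344 * (((2 : ℕ) : ℝ) + 1) * (((2 : ℕ) : ℝ) + 2) ^ 2 * (((2 : ℕ) : ℝ) + 5) * (((ℓ + 1 : ℕ) : ℝ)) ^ (2 + 4)) *
          (Cτ * betaTau τ))) * aT) * (2 * (BE * B6.c1 d' δE (1 - α) * (((ℓ + 1 : ℕ) : ℝ)) ^ 4)) ≤ 1 →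
      aT ≤ cP →
    ∀ α₀' : ℝ, 0 < α₀' → α₀' ≤ aJ → C0 (2 + 1) * α₀' ≤ 1 / 3 → 2 * α₀' ≤ c2' (2 + 1) (ℓ + 1) → aT * (((ℓ + 1 : ℕ) : ℝ)) ^ (2 * 1) < α₀' →
    ∃ a₀' : ℝ, 0 < a₀' ∧ ∃ k₀ : ℕ, ∃ cα : ℝ, 0 < cα ∧
    ∀ cL : ℝ, 0 < cL → cL * (((ℓ + 1 : ℕ) : ℝ)) ^ 2 < a₀' →
      cL ≤ min (1 / 16) (min aT (min aT (1 / (2 * (2 * (2 * (BE * B6.c1 d' δE (1 - α) * (((ℓ + 1 : ℕ) : ℝ)) ^ 4))) * (14 * ((2 + 1 - 1 : ℕ) : ℝ)) * M + 1)))) →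
      cL ≤ cα →
    ∃ B₁' B₂ c₁ : ℝ, 0 < B₁' ∧ 0 < B₂ ∧ 0 < c₁ ∧
    ∀ F : T3Family, F.L = ℓ + 1 → ∀ (n K : ℕ), n < K →
      (((F.P K).sitesPerDir 0 : ℕ) : ℤ) ∣ (((PV 2 ℓ (F.m + k₀) K hd₃ hL).sitesPerDir 0 : ℕ) : ℤ) ∧
      (((ℓ + 1 : ℕ) : ℤ)) ^ (K - n) ∣ (((F.P K).sitesPerDir 0 : ℕ) : ℤ) ∧
      Thm2TorusAt (ℓ + 1) (K - n) ((((PV 2 ℓ (F.m + k₀) K hd₃ hL).sitesPerDir 0 : ℕ) : ℤ)) (eta F n K) 0 B₁' B₂ c₁ len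
        (specialUnitaryUnits (Fin 2)) (fun _ => True) := by
  letI : CStarAlgebra (Matrix (Fin 2) (Fin 2) ℂ) := {}
  haveI : Nonempty (Fin 2) := ⟨0⟩
  intro HA
  obtain ⟨δA, KA, M₀, T₀, N₀, hδA, hKA, a₁, ha₁, δh₀, hδh₀, HA'⟩ := HA
  refine ⟨δA, hδA, ?_⟩
  -- the form of record at the assembler's rate
  obtain ⟨d', A₀, HF⟩ := hThm2Cover_of_prop6_deltaAMembers (hd₃ := hd₃) (hL := hL) (len := len) hℓ τ hτ hτt hCτ hM1 hδA hαE0 hα1 b hM₂ hrepr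
    Rr Hp Hg
  -- the assembler's member thresholds above one exponent
  obtain ⟨A₁, HA₁⟩ := exists_threshold_exponent (d := 2) (hd := hd₃) (hL := hL) (b₀ := (1 : ℝ)) (b₁ := (1 : ℝ)) (by omega : 2 ≤ ℓ) M₀ T₀ N₀
  refine ⟨d', max A₀ A₁, fun a' ha' => ?_⟩
  obtain ⟨cP, hcP, HP⟩ := HF a' ((le_max_left _ _).trans ha')
  -- Prop. 6's smallness for the assembler's size `a₁` at `M_h = L^{a′}`
  obtain ⟨cP', hcP', HP'⟩ := exists_cubeData_of_prop6 (N := 2) (d := 2) (hd := hd₃) (hL := hL) (b₀ := (1 : ℝ)) (b₁ := (1 : ℝ)) (by norm_num) hℓ a' ha₁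
  refine ⟨min cP (min cP' δh₀), lt_min hcP (lt_min hcP' hδh₀), max KA 1, lt_of_lt_of_le one_pos (le_max_right _ _), ?_⟩
  obtain ⟨aJ, haJ, HJ⟩ := HP (max KA 1) (lt_of_lt_of_le one_pos (le_max_right _ _))
  refine ⟨aJ, haJ, fun aT haT haTQ haT3 haT2 hεB haTP α₀' hα₀ hα₀le hα₀3 hα₀2 hslack => ?_⟩
  have haTP₀ : aT ≤ cP := haTP.trans (min_le_left _ _)
  have haTP' : aT ≤ cP' := haTP.trans ((min_le_right _ _).trans (min_le_left _ _))
  have haTδ : aT ≤ δh₀ := haTP.trans ((min_le_right _ _).trans (min_le_right _ _))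
  obtain ⟨a₀', ha₀', k₀, cα, hcα, HC⟩ := HJ aT haT haTQ haT3 haT2 hεB haTP₀ α₀' hα₀ hα₀le hα₀3 hα₀2 hslack
  refine ⟨a₀', ha₀', k₀, cα, hcα, fun cL hcL hαe hcLP hcLα => ?_⟩
  obtain ⟨B₁', B₂, c₁, hB₁', hB₂, hc₁, HT⟩ := HC cL hcL hαe hcLP hcLα
  refine ⟨B₁', B₂, c₁, hB₁', hB₂, hc₁, fun F hF n K hnK => HT F hF n K hnK ?_⟩
  -- the per-member binder (1ₛ) ∧ (Eₛ) from the assembler + Prop. 6's cube data + the knit-side plaquette datum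
  intro i m' h1 hmK hk hD hMh hcf hw hper α₀ U₀ hU₀ hU₀per hα₀0 hα₀T hAk
  obtain ⟨hMm, hNm, hTm⟩ := HA₁ a' ((le_max_right _ _).trans ha') i hMh
  have hcfk : i.cf = (((ℓ + 1 : ℕ) : ℝ)) ^ i.k := by rw [hk]; exact hcf
  have hsurj : Function.Surjective (β i.hN i.D i.hk) := surjective_beta_kIdx_of_constLev i hk hD
  have hι : ∀ s : BlkY i, β i.hN i.D i.hk (Function.surjInv hsurj s) = s := fun s => Function.surjInv_eq hsurj s
  have hU : ∀ μ x, bgY i U₀ μ x ∈ unitaryUnits (Matrix (Fin 2) (Fin 2) ℂ) := bgY_mem i hU₀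
  have hU₀per' : ∀ (x : LSite (2 + 1)) (μ : Fin (2 + 1)), U₀ (x + (((PV 2 ℓ i.m i.K hd₃ hL).sitesPerDir 0 : ℕ) : ℤ) • e μ) = U₀ x := by
    rw [hper]; exact fun x μ => hU₀per x (e μ)
  have hperi : IsPeriodic ((PV 2 ℓ i.m i.K hd₃ hL).sitesPerDir 0) U₀ := by rw [hper]; exact hU₀per
  -- the plaquette datum at `δh := α₀`
  have hlev : ∀ z : SiteY i, levY i z = m' := fun z => hD z.1
  have hreg : Reg17 (ℓ + 1) m' (fun _ => (Set.univ : Set (LSite (2 + 1)))) α₀ U₀ := reg17_of_inAk hAk le_rfl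
  have hW : ∀ p : PlaqY i, ‖((holY i (bgY i U₀) p : (Matrix (Fin 2) (Fin 2) ℂ)ˣ) : Matrix (Fin 2) (Fin 2) ℂ) - 1‖ ≤
      α₀ * ((((ℓ : ℝ) + 1) ^ levY i (chartY i p.src))⁻¹) ^ 2 := by
    intro p
    have h := (norm_holY_bgY_sub_one_lt i hperi hreg p).le
    rw [hlev]
    simpa [Nat.cast_succ] using h
  -- Prop. 6's per-cube (3.35) data for `bgY i U₀`
  obtain ⟨g, A, Q, C, ξ, Λ, hg, hC0, hξ, hΛ, hξS, hΛξ, hQ, hgA, hAb, hdA, hs₁, hs₄⟩ :=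
    HP' i m' hD hk hMh (eta F n K) α₀ U₀ hU₀ hU₀per' (eta_pos F n K) hα₀0 (hα₀T.trans haTP') hAk
  -- the assembler at this member
  have key := fun (B : B9.Backgrounds) => HA' i hMm hNm hTm hcfk (Function.surjInv hsurj) hι (bgY i U₀) hU α₀ hα₀0.le (hα₀T.trans haTδ) hW
    g hg A Q C ξ Λ hC0 hξ hΛ hξS hΛξ hQ hgA hAb hdA hs₁ hs₄ (B := B)
  refine ⟨?_, ?_⟩
  · -- (1ₛ) from the one-point background family
    let B : B9.Backgrounds :=
      { Cfg := Unit, one := (), mul := fun _ _ => (), Reg335 := fun _ _ _ => True, Reg336 := fun _ _ _ => True,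
        Cplx337 := fun _ _ _ => True, Cplx338 := fun _ _ _ => True }
    exact (key B (fun _ => bgY i U₀) (parBY i) () rfl).1
  · -- (Eₛ) at the caller's background family, constant weakened to `max KA 1`
    intro B cfg par U₁ hcfg
    exact eBlock_mono' i _ (le_max_left _ _) le_rfl (zero_le_one.trans (le_max_right _ _)) (key B cfg par U₁ hcfg).2

end Literature.MathematicalPhysics.QuantumFieldTheory.Balaban1983to89.B8Thm2TorusCoverOfDeltaAAssembler

end
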